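import Mathlib
import HarnessLib
import Summits.ValiantsHypothesis.ValiantsHypothesis.Theorems.SymmetryDialAffinePebbleThree
import Summits.ValiantsHypothesis.ValiantsHypothesis.Theorems.SymmetryDialPerCongruence

/-!
# SymmetryDial — translation orbits on the terms of `per M_f` (kernel (θ₁), part 1 of 3)

Route `route-ValiantsHypothesis-SymmetryDial`, item A₂ = `SymHardAffineSupported`
(stmt-ValiantsHypothesis-23711), instrument P′ = `SymmetryDialAffinePebble.AffinePebblePairs`.
Supporting kernel for the decomposition workshop (lineage decomp-val-lens-1, g7).

For a group matrix `M_f[x,y] = f(x+y)` over `𝔽₂^d` the additive group acts on the nonzero terms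
`admissible M_f` of the permanent by conjugation with translations (`tconj`).  This file: the action,
stabilisers `stab` (additive subgroups, sizes `2^j`), orbits `orb` (orbit–stabiliser
`card_orb_mul_card_stab`), and the hyperplane dictionary: an index-two stabiliser is `ker ξ` for a
unique `ξ ≠ 0` (`exists_kerSet_of_card`), and a stabiliser containing `ker ξ` is `ker ξ` or everything
(`stab_eq_or_univ`).  Parts 2–3: `SymmetryDialShiftPerm` (the `ker ξ`-equivariant count
`E(ξ) = k_ξ² + k'_ξ²`) and `SymmetryDialPerModFour` (the decomposition and `per mod 4`).
-/

set_option linter.dupNamespace false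

namespace Summit.ValiantsHypothesis.ValiantsHypothesis.Theorems.SymmetryDialTranslationOrbits

open Finset Equiv
open SymmetryDialAffinePebble (V pair)
open SymmetryDialAffinePebbleThree (grpMat)
open SymmetryDialPerCongruence (admissible mem_admissible two_nsmul_eq_zero)

variable {d : ℕ}

/-! ### 1. Arithmetic in `𝔽₂^d` -/

/-- `t + (t + x) = x`. -/
theorem add_add_cancel_left (t x : V d) : t + (t + x) = x := by
  rw [← add_assoc, two_nsmul_eq_zero, zero_add]

/-- `−t = t`. -/
theorem neg_eq_self' (t : V d) : -t = t := neg_eq_of_add_eq_zero_left (two_nsmul_eq_zero t)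

/-- Every element of `Fin 2` is `0` or `1` (file-local copy of a two-line triviality). -/
private theorem fin2_cases (a : Fin 2) : a = 0 ∨ a = 1 := by
  fin_cases a <;> simp

/-- In `Fin 2`, `a ≠ 0 ↔ a = 1`. -/
theorem fin2_ne_zero_iff {a : Fin 2} : a ≠ 0 ↔ a = 1 := by
  rcases fin2_cases a with rfl | rfl <;> decide

/-- `a + a = 0` in `Fin 2`. -/
theorem fin2_add_self (a : Fin 2) : a + a = 0 := by
  rcases fin2_cases a with rfl | rfl <;> decide

/-- `pair` is additive in the second argument. -/
theorem pair_add (ξ v w : V d) : pair ξ (v + w) = pair ξ v + pair ξ w := by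
  simp only [pair, Pi.add_apply, mul_add, sum_add_distrib]

/-- `pair ξ 0 = 0`. -/
theorem pair_zero_right (ξ : V d) : pair ξ 0 = 0 := by
  simp [pair]

/-- `pair 0 v = 0`. -/
theorem pair_zero_left (v : V d) : pair 0 v = 0 := by
  simp [pair]

/-- `pair ξ eᵢ = ξ i`. -/
theorem pair_single (ξ : V d) (i : Fin d) : pair ξ (Pi.single i 1) = ξ i := by
  simp only [pair, Pi.single_apply, mul_ite, mul_one, mul_zero, sum_ite_eq', mem_univ, if_true]

/-- A nonzero `ξ` takes the value `1` somewhere. -/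
theorem exists_pair_eq_one {ξ : V d} (hξ : ξ ≠ 0) : ∃ u, pair ξ u = 1 := by
  obtain ⟨i, hi⟩ := Function.ne_iff.1 hξ
  exact ⟨Pi.single i 1, by rw [pair_single]; exact fin2_ne_zero_iff.1 (by simpa using hi)⟩

/-- `#𝔽₂^d = 2^d`. -/
theorem card_V : Fintype.card (V d) = 2 ^ d := by
  simp [V, Fintype.card_fin]

/-! ### 2. Conjugating a permutation by a translation -/

/-- `σ ↦ τ_t ∘ σ ∘ τ_t`, the conjugate of `σ` by the translation `x ↦ t + x` (an involution). -/
def tconj (t : V d) (σ : Perm (V d)) : Perm (V d) := Equiv.addLeft t * σ * Equiv.addLeft t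

/-- `tconj t σ x = t + σ (t + x)`. -/
@[simp] theorem tconj_apply (t : V d) (σ : Perm (V d)) (x : V d) :
    tconj t σ x = t + σ (t + x) := by
  simp [tconj, Perm.mul_apply]

/-- `tconj 0 = id`. -/
theorem tconj_zero (σ : Perm (V d)) : tconj 0 σ = σ :=
  Equiv.ext fun x => by simp

/-- `tconj` is an action of the additive group `𝔽₂^d`. -/
theorem tconj_add (s t : V d) (σ : Perm (V d)) : tconj (s + t) σ = tconj s (tconj t σ) := by
  refine Equiv.ext fun x => ?_
  simp only [tconj_apply]
  rw [show t + (s + x) = s + t + x by abel]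
  abel

/-- `tconj t` is an involution. -/
theorem tconj_self (t : V d) (σ : Perm (V d)) : tconj t (tconj t σ) = σ := by
  rw [← tconj_add, two_nsmul_eq_zero, tconj_zero]

/-- The action is commutative. -/
theorem tconj_comm (s t : V d) (σ : Perm (V d)) : tconj s (tconj t σ) = tconj t (tconj s σ) := by
  rw [← tconj_add, add_comm, tconj_add]

/-- `tconj t` is injective. -/
theorem tconj_injective (t : V d) : Function.Injective (tconj t) := fun σ τ h => by
  simpa [tconj_self] using congrArg (tconj t) h

/-- Translations are symmetries of group matrices: conjugates of admissible permutations are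
admissible. -/
theorem tconj_mem_admissible {f : V d → Bool} {σ : Perm (V d)} (hσ : σ ∈ admissible (grpMat f))
    (t : V d) : tconj t σ ∈ admissible (grpMat f) := by
  rw [mem_admissible] at hσ ⊢
  intro i
  have h := hσ (t + i)
  simp only [grpMat, tconj_apply] at h ⊢
  rwa [show t + σ (t + i) + i = σ (t + i) + (t + i) by abel]

/-! ### 3. Stabilisers and orbits of the translation action -/

/-- The stabiliser of `σ`: translations commuting with `σ`. -/
def stab (σ : Perm (V d)) : Finset (V d) := univ.filter fun t => tconj t σ = σ

/-- The orbit of `σ` under conjugation by translations. -/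
def orb (σ : Perm (V d)) : Finset (Perm (V d)) := univ.image fun t => tconj t σ

/-- Membership in `stab σ`. -/
theorem mem_stab {σ : Perm (V d)} {t : V d} : t ∈ stab σ ↔ tconj t σ = σ := by simp [stab]

/-- Membership in `orb σ`. -/
theorem mem_orb {σ τ : Perm (V d)} : τ ∈ orb σ ↔ ∃ t, tconj t σ = τ := by simp [orb]

/-- `0 ∈ stab σ`. -/
theorem zero_mem_stab (σ : Perm (V d)) : (0 : V d) ∈ stab σ := mem_stab.2 (tconj_zero σ)

/-- `stab σ` is closed under addition. -/
theorem add_mem_stab {σ : Perm (V d)} {s t : V d} (hs : s ∈ stab σ) (ht : t ∈ stab σ) :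
    s + t ∈ stab σ := by
  rw [mem_stab] at *
  rw [tconj_add, ht, hs]

/-- `σ ∈ orb σ`. -/
theorem self_mem_orb (σ : Perm (V d)) : σ ∈ orb σ := mem_orb.2 ⟨0, tconj_zero σ⟩

/-- `tconj t σ ∈ orb σ`. -/
theorem tconj_mem_orb (σ : Perm (V d)) (t : V d) : tconj t σ ∈ orb σ := mem_orb.2 ⟨t, rfl⟩

/-- The stabiliser as an additive subgroup of `𝔽₂^d`. -/
def stabGrp (σ : Perm (V d)) : AddSubgroup (V d) where
  carrier := {t | tconj t σ = σ}
  zero_mem' := tconj_zero σ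
  add_mem' := fun {s t} hs ht => by
    simp only [Set.mem_setOf_eq] at *
    rw [tconj_add, ht, hs]
  neg_mem' := fun {t} ht => by
    simp only [Set.mem_setOf_eq] at *
    rwa [neg_eq_self']

/-- Membership in `stabGrp σ`. -/
theorem mem_stabGrp {σ : Perm (V d)} {t : V d} : t ∈ stabGrp σ ↔ tconj t σ = σ := Iff.rfl

/-- Lagrange: the stabiliser's size divides `2^d`. -/
theorem card_stab_dvd (σ : Perm (V d)) : (stab σ).card ∣ 2 ^ d := by
  have h1 : Nat.card (stabGrp σ) = (stab σ).card := by
    rw [Nat.card_congr (Equiv.subtypeEquivRight (fun t => (mem_stabGrp).trans mem_stab.symm) :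
      stabGrp σ ≃ {t // t ∈ stab σ}), Nat.card_eq_fintype_card, Fintype.card_coe]
  have h2 := AddSubgroup.card_addSubgroup_dvd_card (stabGrp σ)
  rwa [h1, Nat.card_eq_fintype_card, card_V] at h2

/-- … hence is a power of two. -/
theorem card_stab_pow (σ : Perm (V d)) : ∃ j, j ≤ d ∧ (stab σ).card = 2 ^ j :=
  (Nat.dvd_prime_pow Nat.prime_two).1 (card_stab_dvd σ)

/-- Orbit–stabiliser: `#orb σ · #stab σ = 2^d`. -/
theorem card_orb_mul_card_stab (σ : Perm (V d)) : (orb σ).card * (stab σ).card = 2 ^ d := by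
  have hfib := Finset.card_eq_sum_card_fiberwise (s := (univ : Finset (V d))) (t := orb σ)
    (f := fun t => tconj t σ) (fun t _ => tconj_mem_orb σ t)
  have hconst : ∀ τ ∈ orb σ,
      ((univ : Finset (V d)).filter fun t => tconj t σ = τ).card = (stab σ).card := by
    intro τ hτ
    obtain ⟨t₀, rfl⟩ := mem_orb.1 hτ
    have : ((univ : Finset (V d)).filter fun t => tconj t σ = tconj t₀ σ) =
        (stab σ).image fun s => t₀ + s := by
      ext t
      simp only [mem_filter, mem_univ, true_and, mem_image, mem_stab]
      constructor
      · intro h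
        refine ⟨t₀ + t, ?_, add_add_cancel_left t₀ t⟩
        rw [tconj_add, h, tconj_self]
      · rintro ⟨s, hs, rfl⟩
        rw [tconj_add, hs]
    rw [this, card_image_of_injective _ (add_right_injective t₀)]
  rw [sum_congr rfl hconst, sum_const, smul_eq_mul, card_univ, card_V] at hfib
  exact hfib.symm

/-- Orbit sizes are powers of two. -/
theorem card_orb_pow (σ : Perm (V d)) : ∃ j, j ≤ d ∧ (orb σ).card = 2 ^ j :=
  (Nat.dvd_prime_pow Nat.prime_two).1 (Dvd.intro _ (card_orb_mul_card_stab σ))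

/-- Orbits of orbit members coincide. -/
theorem orb_eq_of_mem {σ τ : Perm (V d)} (h : τ ∈ orb σ) : orb τ = orb σ := by
  obtain ⟨t₀, rfl⟩ := mem_orb.1 h
  ext ρ
  simp only [mem_orb]
  constructor
  · rintro ⟨t, rfl⟩
    exact ⟨t + t₀, tconj_add t t₀ σ⟩
  · rintro ⟨t, rfl⟩
    exact ⟨t + t₀, by rw [tconj_add, tconj_self]⟩

/-- Stabilisers are constant along orbits (the group is abelian). -/
theorem stab_eq_of_mem {σ τ : Perm (V d)} (h : τ ∈ orb σ) : stab τ = stab σ := by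
  obtain ⟨t₀, rfl⟩ := mem_orb.1 h
  ext s
  simp only [mem_stab]
  rw [tconj_comm]
  exact (tconj_injective t₀).eq_iff

/-- Orbits of admissible permutations stay admissible. -/
theorem orb_subset {f : V d → Bool} {σ : Perm (V d)} (hσ : σ ∈ admissible (grpMat f)) :
    orb σ ⊆ admissible (grpMat f) := by
  intro τ hτ
  obtain ⟨t, rfl⟩ := mem_orb.1 hτ
  exact tconj_mem_admissible hσ t

/-- `stab σ = univ` iff every translation commutes with `σ`. -/
theorem stab_eq_univ_iff {σ : Perm (V d)} : stab σ = univ ↔ ∀ t, tconj t σ = σ := by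
  simp [stab, eq_univ_iff_forall]

/-! ### 4. Hyperplanes: index-two subgroups are kernels of nonzero functionals -/

/-- `ker ξ = {v : ξ·v = 0}`. -/
def kerSet (ξ : V d) : Finset (V d) := univ.filter fun v => pair ξ v = 0

/-- Membership in `kerSet ξ`. -/
theorem mem_kerSet {ξ v : V d} : v ∈ kerSet ξ ↔ pair ξ v = 0 := by simp [kerSet]

/-- `ker 0` is everything. -/
theorem kerSet_zero : kerSet (0 : V d) = univ := by
  simp [kerSet, pair_zero_left]

/-- `ker ξ` is proper for `ξ ≠ 0`. -/
theorem kerSet_ne_univ {ξ : V d} (hξ : ξ ≠ 0) : kerSet ξ ≠ univ := by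
  obtain ⟨u, hu⟩ := exists_pair_eq_one hξ
  intro h
  have := mem_kerSet.1 (h ▸ mem_univ u)
  rw [hu] at this
  exact absurd this (by decide)

/-- `ξ ↦ ker ξ` is injective. -/
theorem kerSet_injective : Function.Injective (kerSet (d := d)) := by
  intro ξ ξ' h
  funext i
  have h1 : Pi.single i (1 : Fin 2) ∈ kerSet ξ ↔ Pi.single i (1 : Fin 2) ∈ kerSet ξ' := by rw [h]
  rw [mem_kerSet, mem_kerSet, pair_single, pair_single] at h1
  rcases fin2_cases (ξ i) with h0 | h0 <;> rcases fin2_cases (ξ' i) with h0' | h0' <;>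
    simp_all

/-- In an index-two stabiliser the sum of two non-members is a member (the complement is a coset). -/
theorem add_mem_stab_of_not_mem {σ : Perm (V d)} (h2 : (stab σ).card * 2 = 2 ^ d) {v w : V d}
    (hv : v ∉ stab σ) (hw : w ∉ stab σ) : v + w ∈ stab σ := by
  have himg : (stab σ).image (fun k => v + k) ⊆ univ \ stab σ := by
    intro x hx
    obtain ⟨k, hk, rfl⟩ := mem_image.1 hx
    rw [mem_sdiff]
    refine ⟨mem_univ _, fun hvk => hv ?_⟩
    have := add_mem_stab hvk hk
    rwa [add_assoc, two_nsmul_eq_zero, add_zero] at this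
  have hcard : (univ \ stab σ).card ≤ ((stab σ).image fun k => v + k).card := by
    rw [card_image_of_injective _ (add_right_injective v), card_sdiff, inter_univ, card_univ, card_V]
    omega
  have heq := eq_of_subset_of_card_le himg hcard
  have hw' : w ∈ univ \ stab σ := mem_sdiff.2 ⟨mem_univ _, hw⟩
  rw [← heq] at hw'
  obtain ⟨k, hk, rfl⟩ := mem_image.1 hw'
  rwa [add_add_cancel_left]

/-- **Index-two stabilisers are hyperplanes**: `#stab σ = 2^{d-1}` forces `stab σ = ker ξ`, `ξ ≠ 0`. -/
theorem exists_kerSet_of_card {σ : Perm (V d)} (h2 : (stab σ).card * 2 = 2 ^ d) :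
    ∃ ξ : V d, ξ ≠ 0 ∧ stab σ = kerSet ξ := by
  -- the indicator of the complement is an additive functional
  let φ : V d →+ Fin 2 :=
    { toFun := fun v => if v ∈ stab σ then 0 else 1
      map_zero' := by simp [zero_mem_stab]
      map_add' := fun v w => by
        by_cases hv : v ∈ stab σ <;> by_cases hw : w ∈ stab σ
        · simp [hv, hw, add_mem_stab hv hw]
        · have : v + w ∉ stab σ := fun hvw => hw (by
            have := add_mem_stab hv hvw; rwa [add_add_cancel_left] at this)
          simp [hv, hw, this]
        · have : v + w ∉ stab σ := fun hvw => hv (by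
            have := add_mem_stab hvw hw; rwa [add_assoc, two_nsmul_eq_zero, add_zero] at this)
          simp [hv, hw, this]
        · simp [hv, hw, add_mem_stab_of_not_mem h2 hv hw] }
  have hφ : ∀ v, φ v = if v ∈ stab σ then 0 else 1 := fun v => rfl
  -- it is `pair ξ` for the vector of its values on the standard basis
  let ξ : V d := fun i => φ (Pi.single i 1)
  have hpair : ∀ v, pair ξ v = φ v := by
    intro v
    conv_rhs => rw [← Finset.univ_sum_single v]
    rw [map_sum]
    simp only [pair, ξ]
    refine sum_congr rfl fun i _ => ?_
    rcases fin2_cases (v i) with h0 | h0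
    · rw [h0]; simp
    · rw [h0]; simp
  -- the stabiliser is proper, so ξ ≠ 0
  have hne : stab σ ≠ univ := by
    intro hu
    rw [hu, card_univ, card_V] at h2
    have := Nat.two_pow_pos d
    omega
  obtain ⟨v, hv⟩ : ∃ v, v ∉ stab σ :=
    not_forall.1 fun hc => hne (eq_univ_iff_forall.2 hc)
  refine ⟨ξ, fun h0 => ?_, ?_⟩
  · have := hpair v
    rw [h0, pair_zero_left, hφ, if_neg hv] at this
    exact absurd this (by decide)
  · ext w
    rw [mem_kerSet, hpair, hφ]
    by_cases hw : w ∈ stab σ <;> simp [hw]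

/-- A stabiliser containing a hyperplane is the hyperplane or everything. -/
theorem stab_eq_or_univ {σ : Perm (V d)} {ξ : V d} (h : kerSet ξ ⊆ stab σ) :
    stab σ = kerSet ξ ∨ stab σ = univ := by
  by_cases hK : stab σ ⊆ kerSet ξ
  · exact Or.inl (Subset.antisymm hK h)
  · right
    obtain ⟨u, hu, huK⟩ := not_subset.1 hK
    rw [mem_kerSet] at huK
    have hu1 : pair ξ u = 1 := fin2_ne_zero_iff.1 huK
    refine eq_univ_iff_forall.2 fun v => ?_
    rcases fin2_cases (pair ξ v) with hv | hv
    · exact h (mem_kerSet.2 hv)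
    · have hvu : v + u ∈ stab σ := h (mem_kerSet.2 (by rw [pair_add, hv, hu1]; decide))
      have := add_mem_stab hvu hu
      rwa [add_assoc, two_nsmul_eq_zero, add_zero] at this

end Summit.ValiantsHypothesis.ValiantsHypothesis.Theorems.SymmetryDialTranslationOrbits
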